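import Literature.Computability.MetaComplexity.BoundedArithAlgebra
import HarnessLib

/-!
# Powers of two, Euclidean division and bits in models of `T₂¹`

Trunk: CplxMeta (G14), topic `Literature/Computability/MetaComplexity`.  Second layer of the
bootstrapping of Buss's theories inside an arbitrary model `M ⊨ BASIC + Σᵇ₁-IND`
(Buss 1986, §§2.4–2.5; Krajíček 1995, §5.4), in the algebraic notation of
`BoundedArithAlgebra.lean` (namespace `Literature.CplxMeta.BASICModel`):

* the length of a successor: `|a + 1| ≤ |a| + 1` (least-number principle);
* Krajíček's predicate `IsPow a` ("`a` is a power of two": `∃ x ≤ a (x + 1 = a ∧ |x| + 1 = |a|)`,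
  Krajíček 1995, p. 75), its `Δᵇ₁`-definability, uniqueness of the power of two of a given
  length, existence of `2ᵏ` for every `k ≤ |b|` (by `Σᵇ₁`-induction), and the resulting
  `Σᵇ₁`-definable function `pow2B b k = 2 ^ min(k, |b|)` with its recursion equations;
* Euclidean division `x / y`, `x % y` (existence by `Σᵇ₁`-induction, uniqueness), as scoped
  `Div`/`Mod` instances, with their `Σᵇ₁`-definability and the usual algebra;
* bits relative to a length bound `S`: `bitB S x k = ⌊x / 2ᵏ⌋ mod 2` (`k ≤ |S|`) and the
  extensionality of the binary representation (`ext_of_bitB`).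

## References

* S. R. Buss, *Bounded Arithmetic*, Bibliopolis 1986, §§2.4–2.5.
* J. Krajíček, *Bounded Arithmetic, Propositional Logic and Complexity Theory*, CUP 1995, §5.4
  (p. 75: `Pow(a)`, `bit(a, i)`).
-/

namespace Literature.Computability.MetaComplexity

namespace BASICModel

open FirstOrder FirstOrder.Language

variable {M : Type} [Language.boundedArith.Structure M] [hB : M ⊨ BASIC]
  [hI : M ⊨ INDScheme (sigmabFormulas 1)]

/-! ## Some term functions and open predicates (algebraic notation) -/

section Terms

omit hI

omit hB in
/-- `|F|` is a term function. [folklore] -/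
theorem isTermFn_mLen {m : ℕ} {F : (Fin m → M) → M} (hF : IsTermFn F) :
    IsTermFn fun xs => mLen (F xs) := hF.len

/-- `F + 1` is a term function. [folklore] -/
theorem isTermFn_add_one {m : ℕ} {F : (Fin m → M) → M} (hF : IsTermFn F) :
    IsTermFn fun xs => F xs + 1 := hF.add isTermFn_one

/-- `2 · F` is a term function. [folklore] -/
theorem isTermFn_two_mul {m : ℕ} {F : (Fin m → M) → M} (hF : IsTermFn F) :
    IsTermFn fun xs => 2 * F xs := isTermFn_two.mul hF

omit hB in
/-- `F = G` is open-definable (algebraic notation). [folklore] -/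
theorem isQFDef_eq {m : ℕ} {F G : (Fin m → M) → M} (hF : IsTermFn F) (hG : IsTermFn G) :
    IsQFDef fun xs => F xs = G xs := IsQFDef.eq hF hG

omit hB in
/-- `F ≠ G` is open-definable. [folklore] -/
theorem isQFDef_ne {m : ℕ} {F G : (Fin m → M) → M} (hF : IsTermFn F) (hG : IsTermFn G) :
    IsQFDef fun xs => F xs ≠ G xs := (IsQFDef.eq hF hG).not

end Terms

/-! ## The length of a successor -/

section LenSucc

omit hI in
/-- `|a| ≤ |a + 1|`. [cite: Buss1986, §2.2] -/
theorem mLen_le_mLen_add_one (a : M) : mLen a ≤ mLen (a + 1) := mLen_le_mLen (le_add_right'' a 1)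

omit hI in
/-- If `a = 2h` with `h ≠ 0` then `|a + 1| = |a|` (odd successors do not increase the length).
[cite: Buss1986, §2.2] -/
theorem mLen_add_one_of_eq_two_mul {a h : M} (hh : h ≠ 0) (ha : a = 2 * h) :
    mLen (a + 1) = mLen a := by
  rw [ha, mLen_two_mul_add_one, mLen_two_mul hh]

omit hI in
/-- `h < 2h + 1`. [folklore] -/
theorem lt_two_mul_add_one (h : M) : h < 2 * h + 1 :=
  lt_of_le_of_lt (by rw [two_mul]; exact le_add_right'' h h) (lt_add_one' _)

/-- **`|a + 1| ≤ |a| + 1`**: the length grows by at most one at a successor.  Proof by the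
`Σᵇ₁` least-number principle: a least counterexample `m` is odd, `m = 2h' + 1`, and then `h'`
is a smaller counterexample (Buss 1986, §2.4). [cite: Buss1986, §2.4] -/
theorem mLen_add_one_le (a : M) : mLen (a + 1) ≤ mLen a + 1 := by
  by_contra hlt
  push Not at hlt
  have hP : IsSigmabDef 1 fun v : Fin 1 → M => mLen (v 0) + 1 < mLen (v 0 + 1) :=
    (isQFDef_lt (isTermFn_add_one (isTermFn_mLen (IsTermFn.proj 0)))
      (isTermFn_mLen (isTermFn_add_one (IsTermFn.proj 0)))).isSigmabDef 1
  obtain ⟨m, hm, hleast⟩ :=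
    exists_least_of_sigmabDef (P := fun m => mLen m + 1 < mLen (m + 1)) hP hlt
  rcases two_mul_mHalf_or (m + 1) with h2 | h2
  · -- `m + 1 = 2h`, `h = h' + 1`, `m = 2h' + 1`
    have hh : mHalf (m + 1) ≠ 0 := by
      intro h0
      rw [h0, mul_zero] at h2
      exact (lt_of_le_of_lt bot_le (lt_add_one' m)).ne h2
    obtain ⟨h', hh'⟩ := exists_eq_add_one_of_ne_zero hh
    have hm' : m = 2 * h' + 1 := by
      have : m + 1 = 2 * h' + 1 + 1 := by rw [← h2, hh']; ring
      exact add_right_cancel this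
    have h1 : mLen m = mLen h' + 1 := by rw [hm', mLen_two_mul_add_one]
    have h3 : mLen (m + 1) = mLen (h' + 1) + 1 := by
      rw [← h2, hh', mLen_two_mul]
      exact (lt_of_le_of_lt bot_le (lt_add_one' h')).ne'
    refine hleast h' ?_ ?_
    · rw [hm']
      exact lt_two_mul_add_one h'
    · rw [h1, h3] at hm
      simpa using hm
  · -- `m + 1 = 2h + 1`, `m = 2h`
    have hm' : m = 2 * mHalf (m + 1) := add_right_cancel h2.symm
    rcases eq_or_ne (mHalf (m + 1)) 0 with h0 | h0
    · rw [h0, mul_zero] at hm'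
      subst hm'
      simp at hm
    · rw [mLen_add_one_of_eq_two_mul h0 hm'] at hm
      exact (lt_add_one' _).not_gt hm |>.elim

/-- The length of a successor is `|a|` or `|a| + 1`. [cite: Buss1986, §2.4] -/
theorem mLen_add_one_eq_or (a : M) : mLen (a + 1) = mLen a ∨ mLen (a + 1) = mLen a + 1 := by
  rcases (mLen_le_mLen_add_one a).eq_or_lt with h | h
  · exact Or.inl h.symm
  · exact Or.inr (le_antisymm (mLen_add_one_le a) ((add_one_le_iff' _ _).2 h))

end LenSucc

/-! ## Powers of two -/

section IsPow

/-- `IsPow a`: `a` is a power of two — `a` is a successor `x + 1` at which the length jumps,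
`|x| + 1 = |a|` (Krajíček 1995, p. 75: `Pow(a) :≡ ∃x ≤ a (x + 1 = a ∧ |x| + 1 = |a|)`).
[cite: Krajicek1995, p. 75] -/
def IsPow (a : M) : Prop :=
  ∃ x, x ≤ a ∧ (x + 1 = a ∧ mLen x + 1 = mLen a)

omit hI in
/-- `IsPow` is `Σᵇ₁`-definable (with parameters), as a bounded `∃` of an open formula
(Krajíček 1995, p. 75, Claim 1). [cite: Krajicek1995, p. 75] -/
theorem isSigmabDef_isPow : IsSigmabDef 1 fun v : Fin 1 → M => IsPow (v 0) := by
  refine (IsSigmabDef.bexLE (i := 0)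
    (R := fun w : Fin 2 → M => w 1 + 1 = w 0 ∧ mLen (w 1) + 1 = mLen (w 0))
    (((isQFDef_eq (isTermFn_add_one (IsTermFn.proj 1)) (IsTermFn.proj 0)).and
      (isQFDef_eq (isTermFn_add_one (isTermFn_mLen (IsTermFn.proj 1)))
        (isTermFn_mLen (IsTermFn.proj 0)))).isSigmabDef 1) (IsTermFn.proj 0)).of_iff fun v => ?_
  simp [IsPow]

omit hI in
/-- A power of two is nonzero. [folklore] -/
theorem IsPow.ne_zero {a : M} (h : IsPow a) : a ≠ 0 := by
  obtain ⟨x, -, hx, -⟩ := h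
  rintro rfl
  exact (lt_of_le_of_lt bot_le (lt_add_one' x)).ne' hx

omit hI in
/-- `1 = 2⁰` is a power of two. [cite: Krajicek1995, p. 75] -/
theorem isPow_one : IsPow (1 : M) := ⟨0, bot_le, zero_add 1, by simp⟩

/-- `IsPow a ↔ a ≠ 0 ∧ |a ∸ 1| + 1 = |a|`. [folklore] -/
theorem isPow_iff {a : M} : IsPow a ↔ a ≠ 0 ∧ mLen (a - 1) + 1 = mLen a := by
  constructor
  · rintro ⟨x, -, rfl, hx⟩
    exact ⟨(lt_of_le_of_lt bot_le (lt_add_one' x)).ne', by rwa [add_tsub_cancel_right]⟩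
  · rintro ⟨ha, h⟩
    obtain ⟨x, rfl⟩ := exists_eq_add_one_of_ne_zero ha
    rw [add_tsub_cancel_right] at h
    exact ⟨x, le_add_right'' x 1, rfl, h⟩

/-- `IsPow` in universal form: `a ≠ 0 ∧ ∀ x ≤ a (x + 1 = a → |x| + 1 = |a|)` (Krajíček 1995,
p. 75: `Pow` is `Δᵇ₁`). [cite: Krajicek1995, p. 75] -/
theorem isPow_iff_forall {a : M} :
    IsPow a ↔ a ≠ 0 ∧ ∀ x, x ≤ a → (x + 1 = a → mLen x + 1 = mLen a) := by
  rw [isPow_iff]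
  refine and_congr_right fun ha => ⟨fun h x _ hx => ?_, fun h => ?_⟩
  · subst hx
    rwa [add_tsub_cancel_right] at h
  · obtain ⟨x, rfl⟩ := exists_eq_add_one_of_ne_zero ha
    rw [add_tsub_cancel_right]
    exact h x (le_add_right'' x 1) rfl

/-- `IsPow` is `Πᵇ₁`-definable (Krajíček 1995, p. 75, Claim 1). [cite: Krajicek1995, p. 75] -/
theorem isPibDef_isPow : IsPibDef 1 fun v : Fin 1 → M => IsPow (v 0) := by
  refine (((isQFDef_ne (IsTermFn.proj 0) isTermFn_zero).isPibDef 1).and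
    (IsPibDef.ballLE (i := 0)
      (R := fun w : Fin 2 → M => w 1 + 1 = w 0 → mLen (w 1) + 1 = mLen (w 0))
      (((isQFDef_eq (isTermFn_add_one (IsTermFn.proj 1)) (IsTermFn.proj 0)).imp
        (isQFDef_eq (isTermFn_add_one (isTermFn_mLen (IsTermFn.proj 1)))
          (isTermFn_mLen (IsTermFn.proj 0)))).isPibDef 1) (IsTermFn.proj 0))).of_iff fun v => ?_
  simp [isPow_iff_forall]

/-- `IsPow` is `Δᵇ₁`-definable (Krajíček 1995, p. 75, Claim 1). [cite: Krajicek1995, p. 75] -/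
theorem isDeltabDef_isPow : IsDeltabDef 1 fun v : Fin 1 → M => IsPow (v 0) :=
  ⟨isSigmabDef_isPow, isPibDef_isPow⟩

omit hI in
/-- A power of two exceeds exactly the numbers of smaller length: `b < p ↔ |b| < |p|`.
[folklore] -/
theorem IsPow.lt_iff_mLen_lt {p : M} (hp : IsPow p) (b : M) : b < p ↔ mLen b < mLen p := by
  obtain ⟨x, -, rfl, hx⟩ := hp
  constructor
  · intro h
    rw [← hx]
    exact (lt_add_one_iff' _ _).2 (mLen_le_mLen ((lt_add_one_iff' b x).1 h))
  · exact lt_of_mLen_lt_mLen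

omit hI in
/-- `p ≤ b ↔ |p| ≤ |b|` for a power of two `p`. [folklore] -/
theorem IsPow.le_iff_mLen_le {p : M} (hp : IsPow p) (b : M) : p ≤ b ↔ mLen p ≤ mLen b := by
  rw [← not_lt, hp.lt_iff_mLen_lt, not_lt]

omit hI in
/-- Two powers of two of the same length are equal (Krajíček 1995, p. 75).
[cite: Krajicek1995, p. 75] -/
theorem IsPow.eq_of_mLen_eq {a b : M} (ha : IsPow a) (hb : IsPow b) (h : mLen a = mLen b) :
    a = b :=
  le_antisymm ((ha.le_iff_mLen_le b).2 h.le) ((hb.le_iff_mLen_le a).2 h.ge)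

omit hI in
/-- `2p` is a power of two if `p` is: `2p = (2x + 1) + 1` and `|2x + 1| + 1 = |2p|`.
[cite: Buss1986, §2.4] -/
theorem IsPow.two_mul {p : M} (hp : IsPow p) : IsPow (2 * p) := by
  have hp0 := hp.ne_zero
  obtain ⟨x, -, rfl, hx⟩ := hp
  refine ⟨2 * x + 1, ?_, by rw [mul_add, mul_one, add_assoc, one_add_one_eq_two], ?_⟩
  · rw [mul_add, mul_one, ← one_add_one_eq_two, ← add_assoc]
    exact le_add_right'' _ _
  · rw [mLen_two_mul_add_one, hx, mLen_two_mul hp0]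

omit hI in
/-- The length of `2p` for a power of two `p`. [folklore] -/
theorem IsPow.mLen_two_mul {p : M} (hp : IsPow p) : mLen (2 * p) = mLen p + 1 :=
  BASICModel.mLen_two_mul hp.ne_zero

/-- **Existence of powers of two of small exponent**: for every `k ≤ |b|` there is a power of
two of length `k + 1` (i.e. `2ᵏ`) below `2b + 1`; by `Σᵇ₁`-induction on `k`
(Buss 1986, §2.4; Krajíček 1995, p. 75: `2ˣ = y` is `Δᵇ₁`-definable). [cite: Buss1986, §2.4] -/
theorem exists_isPow_mLen_eq (b : M) {k : M} (hk : k ≤ mLen b) :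
    ∃ p, p ≤ 2 * b + 1 ∧ (IsPow p ∧ mLen p = k + 1) := by
  revert hk
  refine ind (P := fun k => k ≤ mLen b → ∃ p, p ≤ 2 * b + 1 ∧ (IsPow p ∧ mLen p = k + 1))
    ?_ ?_ ?_ k
  · refine IsSigmabDef.imp ((isQFDef_le (IsTermFn.proj 0)
      (isTermFn_mLen (IsTermFn.const b))).isPibDef 1) ?_
    refine (IsSigmabDef.bexLE (i := 0)
      (R := fun w : Fin 2 → M => IsPow (w 1) ∧ mLen (w 1) = w 0 + 1)
      ((isSigmabDef_isPow.comp₁ (IsTermFn.proj 1)).and ((isQFDef_eq (isTermFn_mLen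
        (IsTermFn.proj 1)) (isTermFn_add_one (IsTermFn.proj 0))).isSigmabDef 1))
      (isTermFn_add_one (isTermFn_two_mul (IsTermFn.const b)))).of_iff fun v => ?_
    simp
  · intro _
    exact ⟨1, le_add_left'' 1 _, isPow_one, by simp⟩
  · intro k ih hk
    obtain ⟨p, -, hp, hpk⟩ := ih ((le_add_right'' k 1).trans hk)
    refine ⟨2 * p, ?_, hp.two_mul, by rw [hp.mLen_two_mul, hpk]⟩
    rw [(hp.two_mul).le_iff_mLen_le, hp.mLen_two_mul, hpk, mLen_two_mul_add_one]
    simpa using hk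

/-- `pow2B b k = 2 ^ min(k, |b|)`: the power of two of length `min(k, |b|) + 1` (which exists by
`exists_isPow_mLen_eq` and is unique by `IsPow.eq_of_mLen_eq`); for `k ≤ |b|` this is `2ᵏ`
(Buss 1986, §2.4: the function `2^{min(x,|y|)}`). [cite: Buss1986, §2.4] -/
noncomputable def pow2B (b k : M) : M :=
  Classical.choose (exists_isPow_mLen_eq b (k := min k (mLen b)) (min_le_right _ _))

/-- The defining properties of `pow2B b k`. [cite: Buss1986, §2.4] -/
theorem pow2B_spec (b k : M) :
    pow2B b k ≤ 2 * b + 1 ∧ (IsPow (pow2B b k) ∧ mLen (pow2B b k) = min k (mLen b) + 1) :=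
  Classical.choose_spec (exists_isPow_mLen_eq b (k := min k (mLen b)) (min_le_right _ _))

/-- `pow2B b k` is a power of two. [cite: Buss1986, §2.4] -/
theorem isPow_pow2B (b k : M) : IsPow (pow2B b k) := (pow2B_spec b k).2.1

/-- `|pow2B b k| = min(k, |b|) + 1`. [cite: Buss1986, §2.4] -/
theorem mLen_pow2B (b k : M) : mLen (pow2B b k) = min k (mLen b) + 1 := (pow2B_spec b k).2.2

/-- `|pow2B b k| = k + 1` for `k ≤ |b|`. [cite: Buss1986, §2.4] -/
theorem mLen_pow2B_of_le {b k : M} (hk : k ≤ mLen b) : mLen (pow2B b k) = k + 1 := by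
  rw [mLen_pow2B, min_eq_left hk]

/-- `pow2B b k ≤ 2b + 1`. [cite: Buss1986, §2.4] -/
theorem pow2B_le (b k : M) : pow2B b k ≤ 2 * b + 1 := (pow2B_spec b k).1

/-- `pow2B b k ≠ 0`. [folklore] -/
theorem pow2B_ne_zero (b k : M) : pow2B b k ≠ 0 := (isPow_pow2B b k).ne_zero

/-- `0 < pow2B b k`. [folklore] -/
theorem pow2B_pos (b k : M) : 0 < pow2B b k := (pos_iff_ne_zero' _).2 (pow2B_ne_zero b k)

/-- Characterization of `pow2B b k` by uniqueness: it is the power of two of length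
`min(k, |b|) + 1`. [cite: Buss1986, §2.4] -/
theorem eq_pow2B_iff {b k y : M} : y = pow2B b k ↔ IsPow y ∧ mLen y = min k (mLen b) + 1 := by
  constructor
  · rintro rfl
    exact ⟨isPow_pow2B b k, mLen_pow2B b k⟩
  · rintro ⟨hy, hyl⟩
    exact hy.eq_of_mLen_eq (isPow_pow2B b k) (hyl.trans (mLen_pow2B b k).symm)

/-- `pow2B b 0 = 1`. [cite: Buss1986, §2.4] -/
@[simp] theorem pow2B_zero (b : M) : pow2B b 0 = 1 :=
  (eq_pow2B_iff.2 ⟨isPow_one, by simp⟩).symm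

/-- The recursion `pow2B b (k + 1) = 2 · pow2B b k` for `k < |b|`. [cite: Buss1986, §2.4] -/
theorem pow2B_add_one {b k : M} (hk : k < mLen b) : pow2B b (k + 1) = 2 * pow2B b k := by
  symm
  refine eq_pow2B_iff.2 ⟨(isPow_pow2B b k).two_mul, ?_⟩
  rw [(isPow_pow2B b k).mLen_two_mul, mLen_pow2B_of_le hk.le,
    min_eq_left ((add_one_le_iff' _ _).2 hk)]

/-- `pow2B b k` depends on `k` only through `min(k, |b|)`. [folklore] -/
theorem pow2B_of_mLen_le {b k : M} (hk : mLen b ≤ k) : pow2B b k = pow2B b (mLen b) :=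
  eq_pow2B_iff.2 ⟨isPow_pow2B b k, by rw [mLen_pow2B, min_eq_right hk, min_self]⟩

/-- `pow2B b k = pow2B b' k` as soon as `k ≤ |b|, |b'|` (the value is `2ᵏ`). [folklore] -/
theorem pow2B_congr {b b' k : M} (hk : k ≤ mLen b) (hk' : k ≤ mLen b') :
    pow2B b k = pow2B b' k :=
  eq_pow2B_iff.2 ⟨isPow_pow2B b k, by rw [mLen_pow2B_of_le hk, min_eq_left hk']⟩

/-- `x < pow2B b k ↔ |x| ≤ k` for `k ≤ |b|`: `2ᵏ` exceeds exactly the numbers of length `≤ k`.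
[cite: Buss1986, §2.4] -/
theorem lt_pow2B_iff {b k : M} (hk : k ≤ mLen b) (x : M) : x < pow2B b k ↔ mLen x ≤ k := by
  rw [(isPow_pow2B b k).lt_iff_mLen_lt, mLen_pow2B_of_le hk, lt_add_one_iff']

/-- `pow2B b k ≤ x ↔ k < |x|` for `k ≤ |b|`. [cite: Buss1986, §2.4] -/
theorem pow2B_le_iff {b k : M} (hk : k ≤ mLen b) (x : M) : pow2B b k ≤ x ↔ k < mLen x := by
  rw [← not_lt, lt_pow2B_iff hk, not_le]

/-- `b < pow2B b |b| = 2^{|b|}`. [cite: Buss1986, §2.4] -/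
theorem lt_pow2B_mLen (b : M) : b < pow2B b (mLen b) := (lt_pow2B_iff le_rfl b).2 le_rfl

/-- `x < pow2B b |b|` whenever `|x| ≤ |b|`. [folklore] -/
theorem lt_pow2B_mLen_of_mLen_le {b x : M} (h : mLen x ≤ mLen b) : x < pow2B b (mLen b) :=
  (lt_pow2B_iff le_rfl x).2 h

/-- `pow2B` is monotone in the exponent. [folklore] -/
theorem pow2B_mono (b : M) {j k : M} (h : j ≤ k) : pow2B b j ≤ pow2B b k := by
  rw [(isPow_pow2B b j).le_iff_mLen_le, mLen_pow2B, mLen_pow2B]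
  exact add_le_add (min_le_min_right _ h) le_rfl

/-- `1 ≤ pow2B b k`. [folklore] -/
theorem one_le_pow2B (b k : M) : 1 ≤ pow2B b k := (one_le_iff_ne_zero' _).2 (pow2B_ne_zero b k)

/-- The graph of `pow2B`:
`y = pow2B b k ↔ IsPow y ∧ ((k ≤ |b| ∧ |y| = k + 1) ∨ (|b| < k ∧ |y| = |b| + 1))`. [folklore] -/
theorem eq_pow2B_iff' {b k y : M} : y = pow2B b k ↔
    IsPow y ∧ ((k ≤ mLen b ∧ mLen y = k + 1) ∨ (mLen b < k ∧ mLen y = mLen b + 1)) := by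
  rw [eq_pow2B_iff]
  refine and_congr_right fun _ => ?_
  rcases le_or_gt k (mLen b) with h | h
  · simp [h, h.not_gt]
  · simp [min_eq_right h.le, h, h.not_ge]

/-- **`pow2B` is a `Σᵇ₁`-definable function** (graph `Σᵇ₁`, bounded by the term `2b + 1`)
(Buss 1986, §2.4; Krajíček 1995, p. 75). [cite: Buss1986, §2.4] -/
theorem isSigmabFn_pow2B : IsSigmabFn 1 fun w : Fin 2 → M => pow2B (w 0) (w 1) := by
  refine IsSigmabFn.of_unique (R := fun u : Fin 3 → M => IsPow (u 2) ∧
      ((u 1 ≤ mLen (u 0) ∧ mLen (u 2) = u 1 + 1) ∨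
        (mLen (u 0) < u 1 ∧ mLen (u 2) = mLen (u 0) + 1)))
    ?_ (fun w => ?_) (fun w y hy => ?_) ⟨fun w => 2 * w 0 + 1, ?_, fun w => pow2B_le _ _⟩
  · refine (isSigmabDef_isPow.comp₁ (IsTermFn.proj 2)).and ?_
    exact ((((isQFDef_le (IsTermFn.proj 1) (isTermFn_mLen (IsTermFn.proj 0))).and
      (isQFDef_eq (isTermFn_mLen (IsTermFn.proj 2)) (isTermFn_add_one (IsTermFn.proj 1)))).or
      ((isQFDef_lt (isTermFn_mLen (IsTermFn.proj 0)) (IsTermFn.proj 1)).and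
      (isQFDef_eq (isTermFn_mLen (IsTermFn.proj 2))
        (isTermFn_add_one (isTermFn_mLen (IsTermFn.proj 0)))))).isSigmabDef 1)
  · simpa using (eq_pow2B_iff'.1 (rfl : pow2B (w 0) (w 1) = _))
  · simpa using (eq_pow2B_iff' (b := w 0) (k := w 1) (y := y)).2 (by simpa using hy)
  · exact isTermFn_add_one (isTermFn_two_mul (IsTermFn.proj 0))

/-- `pow2B` is a `Σᵇᵢ₊₁`-definable function for every `i`. [folklore] -/
theorem isSigmabFn_pow2B' (i : ℕ) : IsSigmabFn (i + 1) fun w : Fin 2 → M => pow2B (w 0) (w 1) :=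
  isSigmabFn_pow2B.mono (Nat.le_add_left 1 i)

/-- **Additivity of exponents**: `pow2B b (j + k) = pow2B b j · pow2B b k` when `j + k ≤ |b|`, by
`Σᵇ₁`-induction on `k` (Buss 1986, §2.4: `2^{x+y} = 2ˣ·2ʸ`). [cite: Buss1986, §2.4] -/
theorem pow2B_add {b j k : M} (hjk : j + k ≤ mLen b) :
    pow2B b (j + k) = pow2B b j * pow2B b k := by
  revert hjk
  refine ind (P := fun k => j + k ≤ mLen b → pow2B b (j + k) = pow2B b j * pow2B b k)
    ?_ ?_ ?_ k
  · refine IsSigmabDef.imp ((isQFDef_le ((IsTermFn.const j).add (IsTermFn.proj 0))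
      (isTermFn_mLen (IsTermFn.const b))).isPibDef 1) ?_
    -- `pow2B b (j + k) = pow2B b j * pow2B b k` as an equation between `Σᵇ₁`-functions of `k`
    have hL : IsSigmabFn 1 fun v : Fin 1 → M => pow2B b (j + v 0) :=
      isSigmabFn_pow2B.comp₂ (IsTermFn.const b) ((IsTermFn.const j).add (IsTermFn.proj 0))
    have hR : IsSigmabFn 1 fun v : Fin 1 → M => pow2B b j * pow2B b (v 0) := by
      refine IsSigmabFn.comp₁Fn (f := fun y => pow2B b j * y) (G := fun v => pow2B b (v 0))
        (((IsTermFn.const _).mul (IsTermFn.proj 0)).isSigmabFn (fun a => le_refl a) 1)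
        (isSigmabFn_pow2B.comp₂ (IsTermFn.const b) (IsTermFn.proj 0))
        ⟨fun v => (2 * b + 1) * (2 * b + 1), ?_, fun v => ?_⟩
      · exact (isTermFn_add_one (isTermFn_two_mul (IsTermFn.const b))).mul
          (isTermFn_add_one (isTermFn_two_mul (IsTermFn.const b)))
      · exact mul_le_mul'' (pow2B_le _ _) (pow2B_le _ _)
    exact (hL.isDeltabDef_eq hR).1
  · simp
  · intro k ih hk
    have hk' : j + k < mLen b := lt_of_lt_of_le (by rw [← add_assoc]; exact lt_add_one' _) hk
    rw [← add_assoc, pow2B_add_one hk', ih hk'.le, pow2B_add_one ((le_add_left'' k j).trans_lt hk')]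
    ring

end IsPow

/-! ## Euclidean division -/

section Division

/-- **Existence of quotient and remainder** (`y > 0`): `∃ q ≤ x, ∃ r < y, x = q·y + r`, by
`Σᵇ₁`-induction on `x` (Buss 1986, §2.4). [cite: Buss1986, §2.4] -/
theorem exists_div_mod (x : M) {y : M} (hy : 0 < y) :
    ∃ q, q ≤ x ∧ ∃ r, r ≤ y ∧ (r < y ∧ x = q * y + r) := by
  refine ind (P := fun x => ∃ q, q ≤ x ∧ ∃ r, r ≤ y ∧ (r < y ∧ x = q * y + r)) ?_ ?_ ?_ x
  · refine IsSigmabDef.bexLE (i := 0)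
      (R := fun w : Fin 2 → M => ∃ r, r ≤ y ∧ (r < y ∧ w 0 = w 1 * y + r)) ?_ (IsTermFn.proj 0)
    refine (IsSigmabDef.bexLE (i := 0)
      (R := fun u : Fin 3 → M => u 2 < y ∧ u 0 = u 1 * y + u 2)
      (((isQFDef_lt (IsTermFn.proj 2) (IsTermFn.const y)).and (isQFDef_eq (IsTermFn.proj 0)
        (((IsTermFn.proj 1).mul (IsTermFn.const y)).add (IsTermFn.proj 2)))).isSigmabDef 1)
      (IsTermFn.const y)).of_iff fun w => ?_
    simp
  · exact ⟨0, le_rfl, 0, hy.le, hy, by simp⟩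
  · rintro x ⟨q, hq, r, -, hr, rfl⟩
    rcases ((add_one_le_iff' r y).2 hr).eq_or_lt with h | h
    · refine ⟨q + 1, by simpa using hq, 0, hy.le, hy, ?_⟩
      rw [add_assoc, h]
      ring
    · exact ⟨q, hq.trans (le_add_right'' _ _), r + 1, h.le, h, add_assoc _ _ _⟩

/-- **Uniqueness of quotient and remainder**. [cite: Buss1986, §2.4] -/
theorem div_mod_unique {y q r q' r' : M} (hr : r < y) (hr' : r' < y)
    (h : q * y + r = q' * y + r') : q = q' ∧ r = r' := by
  have key : ∀ {q r q' r' : M}, r < y → q * y + r = q' * y + r' → ¬q < q' := by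
    intro q r q' r' hr h hlt
    have h1 : (q + 1) * y ≤ q' * y := mul_le_mul'' ((add_one_le_iff' q q').2 hlt) le_rfl
    have h2 : q * y + y ≤ q * y + r :=
      calc q * y + y = (q + 1) * y := by ring
        _ ≤ q' * y := h1
        _ ≤ q' * y + r' := le_add_right'' _ _
        _ = q * y + r := h.symm
    exact hr.not_ge (le_of_add_le_add_left h2)
  rcases lt_trichotomy q q' with hlt | rfl | hlt
  · exact (key hr h hlt).elim
  · exact ⟨rfl, add_left_cancel h⟩
  · exact (key hr' h.symm hlt).elim

/-- Division `⌊x / y⌋` in a model of `T₂¹` (with `x / 0 = 0`), from `exists_div_mod`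
(Buss 1986, §2.4). [cite: Buss1986, §2.4] -/
noncomputable scoped instance instDiv : Div M :=
  ⟨fun x y => if hy : 0 < y then Classical.choose (exists_div_mod x hy) else 0⟩

/-- Remainder `x mod y := x ∸ ⌊x/y⌋·y` in a model of `T₂¹` (so `x % 0 = x`)
(Buss 1986, §2.4). [cite: Buss1986, §2.4] -/
noncomputable scoped instance instMod : Mod M := ⟨fun x y => x - x / y * y⟩

/-- Unfolding of `%`. [folklore] -/
theorem mod_def' (x y : M) : x % y = x - x / y * y := rfl

/-- `x / 0 = 0`. [folklore] -/
@[simp] theorem div_zero' (x : M) : x / 0 = 0 := by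
  change (if hy : (0 : M) < 0 then Classical.choose (exists_div_mod x hy) else 0) = 0
  rw [dif_neg (lt_irrefl 0)]

/-- The defining property of `x / y` for `y > 0`. [cite: Buss1986, §2.4] -/
theorem div_spec {x y : M} (hy : 0 < y) :
    x / y ≤ x ∧ ∃ r, r ≤ y ∧ (r < y ∧ x = x / y * y + r) := by
  change (if hy : 0 < y then Classical.choose (exists_div_mod x hy) else 0) ≤ x ∧
    ∃ r, r ≤ y ∧ (r < y ∧ x = (if hy : 0 < y then Classical.choose (exists_div_mod x hy) else 0)
      * y + r)
  rw [dif_pos hy]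
  exact Classical.choose_spec (exists_div_mod x hy)

/-- `⌊x/y⌋·y ≤ x`. [cite: Buss1986, §2.4] -/
theorem div_mul_le' (x y : M) : x / y * y ≤ x := by
  rcases eq_or_ne y 0 with rfl | hy
  · simp
  · obtain ⟨-, r, -, -, h⟩ := div_spec (x := x) ((pos_iff_ne_zero' y).2 hy)
    conv_rhs => rw [h]
    exact le_add_right'' _ _

/-- **Division with remainder**: `⌊x/y⌋·y + x mod y = x`. [cite: Buss1986, §2.4] -/
theorem div_add_mod' (x y : M) : x / y * y + x % y = x :=
  add_tsub_cancel_of_le (div_mul_le' x y)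

/-- `x mod y < y` for `y > 0`. [cite: Buss1986, §2.4] -/
theorem mod_lt' (x : M) {y : M} (hy : 0 < y) : x % y < y := by
  obtain ⟨-, r, -, hr, h⟩ := div_spec (x := x) hy
  have : x % y = r := add_left_cancel ((div_add_mod' x y).trans h)
  rwa [this]

/-- Characterization of quotient and remainder: if `x = q·y + r` with `r < y` then `x / y = q`
and `x mod y = r`. [cite: Buss1986, §2.4] -/
theorem div_mod_eq_of {x y q r : M} (hr : r < y) (h : x = q * y + r) :
    x / y = q ∧ x % y = r := by
  have hy : 0 < y := lt_of_le_of_lt bot_le hr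
  have h' : x / y * y + x % y = q * y + r := (div_add_mod' x y).trans h
  exact div_mod_unique (mod_lt' x hy) hr h'

/-- `x / y ≤ x`. [folklore] -/
theorem div_le_self' (x y : M) : x / y ≤ x := by
  rcases eq_or_ne y 0 with rfl | hy
  · simp
  · exact (div_spec ((pos_iff_ne_zero' y).2 hy)).1

/-- `x mod y ≤ x`. [folklore] -/
theorem mod_le_self' (x y : M) : x % y ≤ x := by
  rw [mod_def']
  exact tsub_le_self

/-- `0 / y = 0`. [folklore] -/
@[simp] theorem zero_div' (y : M) : (0 : M) / y = 0 := le_antisymm (div_le_self' 0 y) bot_le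

/-- `0 mod y = 0`. [folklore] -/
@[simp] theorem zero_mod' (y : M) : (0 : M) % y = 0 := le_antisymm (mod_le_self' 0 y) bot_le

/-- `x mod 0 = x`. [folklore] -/
@[simp] theorem mod_zero' (x : M) : x % 0 = x := by simp [mod_def']

/-- `x / 1 = x`. [folklore] -/
@[simp] theorem div_one' (x : M) : x / 1 = x :=
  (div_mod_eq_of (x := x) (q := x) (r := 0) zero_lt_one (by simp)).1

/-- `x mod 1 = 0`. [folklore] -/
@[simp] theorem mod_one' (x : M) : x % 1 = 0 :=
  (div_mod_eq_of (x := x) (q := x) (r := 0) zero_lt_one (by simp)).2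

/-- `(x + z·y) / y = x / y + z` (`y > 0`). [folklore] -/
theorem add_mul_div' (x z : M) {y : M} (hy : 0 < y) : (x + z * y) / y = x / y + z :=
  (div_mod_eq_of (q := x / y + z) (mod_lt' x hy) (by
    conv_lhs => rw [← div_add_mod' x y]
    ring)).1

/-- `(x + z·y) mod y = x mod y`. [folklore] -/
theorem add_mul_mod' (x z y : M) : (x + z * y) % y = x % y := by
  rcases eq_or_ne y 0 with rfl | hy
  · simp
  · exact (div_mod_eq_of (q := x / y + z) (mod_lt' x ((pos_iff_ne_zero' y).2 hy)) (by
      conv_lhs => rw [← div_add_mod' x y]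
      ring)).2

/-- `(z·y) / y = z` (`y > 0`). [folklore] -/
theorem mul_div_cancel_right'' (z : M) {y : M} (hy : 0 < y) : z * y / y = z := by
  simpa using add_mul_div' 0 z hy

/-- `(z·y) mod y = 0`. [folklore] -/
@[simp] theorem mul_mod_right' (z y : M) : z * y % y = 0 := by
  simpa using add_mul_mod' 0 z y

/-- `x / y = 0 ↔ x < y` (`y > 0`). [folklore] -/
theorem div_eq_zero_iff' {x y : M} (hy : 0 < y) : x / y = 0 ↔ x < y := by
  constructor
  · intro h
    have := div_add_mod' x y
    rw [h, zero_mul, zero_add] at this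
    rw [← this]
    exact mod_lt' x hy
  · intro h
    exact (div_mod_eq_of (q := 0) h (by simp)).1

/-- `x mod y = x` if `x < y`. [folklore] -/
theorem mod_eq_self_of_lt {x y : M} (h : x < y) : x % y = x :=
  (div_mod_eq_of (q := 0) h (by simp)).2

/-- `x < (x / y + 1)·y` (`y > 0`). [folklore] -/
theorem lt_div_add_one_mul (x : M) {y : M} (hy : 0 < y) : x < (x / y + 1) * y := by
  conv_lhs => rw [← div_add_mod' x y]
  rw [add_mul, one_mul]
  exact add_lt_add_of_le_of_lt le_rfl (mod_lt' x hy)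

/-- Division is monotone in the dividend. [folklore] -/
theorem div_le_div_right_model {x x' : M} (h : x ≤ x') (y : M) : x / y ≤ x' / y := by
  rcases eq_or_ne y 0 with rfl | hy
  · simp
  · have hy' := (pos_iff_ne_zero' y).2 hy
    by_contra hlt
    push Not at hlt
    have h1 : (x' / y + 1) * y ≤ x / y * y := mul_le_mul'' ((add_one_le_iff' _ _).2 hlt) le_rfl
    exact (lt_div_add_one_mul x' hy').not_ge (h1.trans ((div_mul_le' x y).trans h))

/-- Characterization of the quotient: `q = x / y ↔ q·y ≤ x < (q + 1)·y` (`y > 0`). [folklore] -/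
theorem eq_div_iff' {x y q : M} (hy : 0 < y) : q = x / y ↔ q * y ≤ x ∧ x < (q + 1) * y := by
  constructor
  · rintro rfl
    exact ⟨div_mul_le' x y, lt_div_add_one_mul x hy⟩
  · rintro ⟨h1, h2⟩
    obtain ⟨r, hr⟩ := exists_add_of_le' h1
    refine (div_mod_eq_of (r := r) ?_ hr).1.symm
    have : q * y + r < q * y + y := by
      calc q * y + r = x := hr.symm
        _ < (q + 1) * y := h2
        _ = q * y + y := by ring
    exact lt_of_add_lt_add_left this

/-- `(x / y) / z = x / (y·z)`. [folklore] -/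
theorem div_div' (x y z : M) : x / y / z = x / (y * z) := by
  rcases eq_or_ne y 0 with rfl | hy
  · simp
  rcases eq_or_ne z 0 with rfl | hz
  · simp
  have hy' := (pos_iff_ne_zero' y).2 hy
  have hz' := (pos_iff_ne_zero' z).2 hz
  have hyz : 0 < y * z := by
    have := mul_le_mul'' ((one_le_iff_ne_zero' y).2 hy) ((one_le_iff_ne_zero' z).2 hz)
    rw [one_mul] at this
    exact lt_of_lt_of_le zero_lt_one this
  -- `x = q·(y·z) + r`, `r < y·z`; then `x / y = q·z + r / y` with `r / y < z`
  set q := x / (y * z) with hq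
  obtain ⟨-, r, -, hr, hx⟩ := div_spec (x := x) hyz
  rw [← hq] at hx
  have h1 : x / y = r / y + q * z :=
    (div_mod_eq_of (mod_lt' r hy') (by
      conv_lhs => rw [hx, ← div_add_mod' r y]
      ring)).1
  have h2 : r / y < z := by
    by_contra hle
    push Not at hle
    have : z * y ≤ r := (mul_le_mul'' hle le_rfl).trans (div_mul_le' r y)
    rw [mul_comm] at this
    exact hr.not_ge this
  rw [h1]
  exact (div_mod_eq_of h2 (by ring)).1

omit hI in
/-- `0 < 2`. [folklore] -/
theorem two_pos' : (0 : M) < 2 :=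
  lt_of_lt_of_le zero_lt_one (by rw [← one_add_one_eq_two]; exact le_add_right'' 1 1)

omit hI in
/-- `1 < 2`. [folklore] -/
theorem one_lt_two' : (1 : M) < 2 := by rw [← one_add_one_eq_two]; exact lt_add_one' 1

/-- `x / 2 = ⌊x/2⌋` (the primitive halving function; axiom 32). [cite: Buss1986, §2.2] -/
theorem div_two_eq_mHalf (x : M) : x / 2 = mHalf x := by
  rcases two_mul_mHalf_or x with h | h
  · exact (div_mod_eq_of (q := mHalf x) (r := 0) two_pos'
      (by rw [mul_comm, add_zero]; exact h.symm)).1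
  · exact (div_mod_eq_of (q := mHalf x) (r := 1) one_lt_two' (by rw [mul_comm]; exact h.symm)).1

/-- `x mod 2 ≤ 1`. [folklore] -/
theorem mod_two_le_one (x : M) : x % 2 ≤ 1 :=
  (lt_add_one_iff' _ _).1 (by rw [one_add_one_eq_two]; exact mod_lt' x two_pos')

/-- `x = 2·(x / 2) + x mod 2`. [folklore] -/
theorem two_mul_div_two_add_mod_two (x : M) : 2 * (x / 2) + x % 2 = x := by
  rw [mul_comm]
  exact div_add_mod' x 2

/-- The graph of division is open-definable:
`q = x / y ↔ (0 < y ∧ q·y ≤ x ∧ x < (q+1)·y) ∨ (y = 0 ∧ q = 0)`. [cite: Buss1986, §2.4] -/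
theorem isQFDef_div_graph : IsQFDef fun w : Fin 3 → M => w 2 = w 0 / w 1 := by
  have h1 : IsQFDef fun w : Fin 3 → M =>
      (0 < w 1 ∧ (w 2 * w 1 ≤ w 0 ∧ w 0 < (w 2 + 1) * w 1)) ∨ (w 1 = 0 ∧ w 2 = 0) :=
    ((isQFDef_lt isTermFn_zero (IsTermFn.proj 1)).and
      ((isQFDef_le ((IsTermFn.proj 2).mul (IsTermFn.proj 1)) (IsTermFn.proj 0)).and
      (isQFDef_lt (IsTermFn.proj 0) ((isTermFn_add_one (IsTermFn.proj 2)).mul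
        (IsTermFn.proj 1))))).or
    ((isQFDef_eq (IsTermFn.proj 1) isTermFn_zero).and
      (isQFDef_eq (IsTermFn.proj 2) isTermFn_zero))
  refine h1.of_iff fun w => ?_
  rcases eq_or_ne (w 1) 0 with h | h
  · simp [h]
  · have h' := (pos_iff_ne_zero' _).2 h
    rw [eq_div_iff' h']
    simp [h, h']

/-- **Division is a `Σᵇᵢ`-definable function** (open graph, bounded by the dividend), for
every `i` (Buss 1986, §2.4). [cite: Buss1986, §2.4] -/
theorem isSigmabFn_div (i : ℕ) : IsSigmabFn i fun w : Fin 2 → M => w 0 / w 1 :=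
  ⟨(isQFDef_div_graph.isSigmabDef i).of_iff fun v => by simp [graphPred, Fin.init],
    fun w => w 0, IsTermFn.proj 0, fun w => div_le_self' _ _⟩

/-- **Remainder is a `Σᵇ₁`-definable function**: `r = x mod y ↔ ∃ q ≤ x (q = x / y ∧ q·y + r = x)`,
bounded by `x` (Buss 1986, §2.4). [cite: Buss1986, §2.4] -/
theorem isSigmabFn_mod : IsSigmabFn 1 fun w : Fin 2 → M => w 0 % w 1 := by
  have hF : IsSigmabFn 1 fun u : Fin 4 → M => u 3 :=
    (IsTermFn.proj 3).isSigmabFn (fun a => le_refl a) 1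
  have hG : IsSigmabFn 1 fun u : Fin 4 → M => u 0 / u 1 :=
    (isSigmabFn_div 1).comp₂ (f := (· / ·)) (IsTermFn.proj 0) (IsTermFn.proj 1)
  have hR : IsSigmabDef 1 fun u : Fin 3 → M =>
      ∃ q, q ≤ u 0 ∧ (q = u 0 / u 1 ∧ q * u 1 + u 2 = u 0) := by
    refine (IsSigmabDef.bexLE (i := 0)
      (R := fun u : Fin 4 → M => u 3 = u 0 / u 1 ∧ u 3 * u 1 + u 2 = u 0)
      ((hF.isDeltabDef_eq hG).1.and ((isQFDef_eq (((IsTermFn.proj 3).mul (IsTermFn.proj 1)).add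
        (IsTermFn.proj 2)) (IsTermFn.proj 0)).isSigmabDef 1)) (IsTermFn.proj 0)).of_iff fun u => ?_
    simp
  refine IsSigmabFn.of_unique hR (fun w => ?_) (fun w r hr => ?_)
    ⟨fun w => w 0, IsTermFn.proj 0, fun w => mod_le_self' _ _⟩
  · simp only [snoc_fin_two_zero, snoc_fin_two_one, snoc_fin_two_two]
    exact ⟨w 0 / w 1, div_le_self' _ _, rfl, div_add_mod' _ _⟩
  · obtain ⟨q, -, hq, h⟩ := hr
    simp only [snoc_fin_two_zero, snoc_fin_two_one, snoc_fin_two_two] at hq h ⊢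
    rw [mod_def', ← hq]
    exact eq_tsub_of_add_eq (by rw [add_comm]; exact h)

/-- Remainder is a `Σᵇᵢ₊₁`-definable function for every `i`. [folklore] -/
theorem isSigmabFn_mod' (i : ℕ) : IsSigmabFn (i + 1) fun w : Fin 2 → M => w 0 % w 1 :=
  isSigmabFn_mod.mono (Nat.le_add_left 1 i)

end Division

/-! ## Bits relative to a length bound -/

section Bits

/-- `bitB S x k = ⌊x / 2ᵏ⌋ mod 2`, the `k`-th bit of `x`, for exponents `k ≤ |S|` (the first
argument only supplies the bound under which `2ᵏ` is taken: `2ᵏ = pow2B S k`)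
(Buss 1986, §2.4 `Bit`; Krajíček 1995, p. 75 `bit(a, i)`). [cite: Krajicek1995, p. 75] -/
noncomputable def bitB (S x k : M) : M := x / pow2B S k % 2

/-- `bitB S x k ≤ 1`. [folklore] -/
theorem bitB_le_one (S x k : M) : bitB S x k ≤ 1 := mod_two_le_one _

/-- Shifting by one more position halves: `⌊x / 2ᵏ⁺¹⌋ = ⌊⌊x / 2ᵏ⌋ / 2⌋` (`k < |S|`). [folklore] -/
theorem div_pow2B_add_one {S k : M} (hk : k < mLen S) (x : M) :
    x / pow2B S (k + 1) = x / pow2B S k / 2 := by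
  rw [pow2B_add_one hk, mul_comm, div_div']

/-- The bit recursion: `⌊x / 2ᵏ⌋ = 2·⌊x / 2ᵏ⁺¹⌋ + bitB S x k` (`k < |S|`). [cite: Buss1986, §2.4] -/
theorem div_pow2B_eq {S k : M} (hk : k < mLen S) (x : M) :
    x / pow2B S k = 2 * (x / pow2B S (k + 1)) + bitB S x k := by
  rw [div_pow2B_add_one hk, bitB, two_mul_div_two_add_mod_two]

/-- `⌊x / 2ᵏ⌋ = 0 ↔ |x| ≤ k` (`k ≤ |S|`). [folklore] -/
theorem div_pow2B_eq_zero_iff {S k : M} (hk : k ≤ mLen S) (x : M) :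
    x / pow2B S k = 0 ↔ mLen x ≤ k := by
  rw [div_eq_zero_iff' (pow2B_pos S k), lt_pow2B_iff hk]

/-- Bits above the length vanish: `|x| ≤ k ≤ |S| → bitB S x k = 0`. [folklore] -/
theorem bitB_eq_zero_of_mLen_le {S x k : M} (hk : k ≤ mLen S) (hx : mLen x ≤ k) :
    bitB S x k = 0 := by
  rw [bitB, (div_pow2B_eq_zero_iff hk x).2 hx, zero_mod']

/-- `bitB S x 0 = x mod 2`. [folklore] -/
@[simp] theorem bitB_zero (S x : M) : bitB S x 0 = x % 2 := by simp [bitB]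

/-- `(S, x, k) ↦ ⌊x / 2ᵏ⌋` (with `2ᵏ = pow2B S k`) is a `Σᵇ₁`-definable function. [folklore] -/
theorem isSigmabFn_div_pow2B : IsSigmabFn 1 fun w : Fin 3 → M => w 1 / pow2B (w 0) (w 2) :=
  (isSigmabFn_div 1).comp₂Fn (f := (· / ·)) (IsTermFn.proj 1)
    (isSigmabFn_pow2B.comp₂ (IsTermFn.proj 0) (IsTermFn.proj 2))
    ⟨fun w => w 1, IsTermFn.proj 1, fun _ => div_le_self' _ _⟩

/-- **`bitB` is a `Σᵇ₁`-definable function** (bounded by `1`) (Krajíček 1995, p. 75: `bit` is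
`Δᵇ₁`). [cite: Krajicek1995, p. 75] -/
theorem isSigmabFn_bitB : IsSigmabFn 1 fun w : Fin 3 → M => bitB (w 0) (w 1) (w 2) :=
  isSigmabFn_mod.comp₂Fn' (f := (· % ·)) isSigmabFn_div_pow2B isTermFn_two
    ⟨fun _ => 1, isTermFn_one, fun _ => mod_two_le_one _⟩

/-- `bitB` is a `Σᵇᵢ₊₁`-definable function for every `i`. [folklore] -/
theorem isSigmabFn_bitB' (i : ℕ) : IsSigmabFn (i + 1) fun w : Fin 3 → M => bitB (w 0) (w 1) (w 2) :=
  isSigmabFn_bitB.mono (Nat.le_add_left 1 i)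

/-- **Extensionality of the binary representation**: two numbers of length `≤ n ≤ |S|` with the
same bits below `n` are equal.  Proof: by `Πᵇ₁`-induction on `j`, `⌊x/2ᵈ⌋ = ⌊y/2ᵈ⌋` for
`d = n - j`, using the bit recursion (Buss 1986, §2.4). [cite: Buss1986, §2.4] -/
theorem ext_of_bitB {S x y n : M} (hn : n ≤ mLen S) (hx : mLen x ≤ n) (hy : mLen y ≤ n)
    (h : ∀ k, k < n → bitB S x k = bitB S y k) : x = y := by
  have key : ∀ j d, d ≤ n → (d + j = n → x / pow2B S d = y / pow2B S d) := by
    intro j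
    refine pib_ind (P := fun j => ∀ d, d ≤ n → (d + j = n → x / pow2B S d = y / pow2B S d))
      ?_ ?_ ?_ j
    · have hF : IsSigmabFn 1 fun w : Fin 2 → M => x / pow2B S (w 1) :=
        isSigmabFn_div_pow2B.comp₃ (f := fun a b c => b / pow2B a c) (IsTermFn.const S)
          (IsTermFn.const x) (IsTermFn.proj 1)
      have hG : IsSigmabFn 1 fun w : Fin 2 → M => y / pow2B S (w 1) :=
        isSigmabFn_div_pow2B.comp₃ (f := fun a b c => b / pow2B a c) (IsTermFn.const S)
          (IsTermFn.const y) (IsTermFn.proj 1)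
      refine (IsPibDef.ballLE (i := 0)
        (R := fun w : Fin 2 → M => w 1 + w 0 = n → x / pow2B S (w 1) = y / pow2B S (w 1))
        (IsPibDef.imp ((isQFDef_eq ((IsTermFn.proj 1).add (IsTermFn.proj 0))
          (IsTermFn.const n)).isSigmabDef 1) (hF.isDeltabDef_eq hG).2) (IsTermFn.const n)).of_iff
        fun v => ?_
      simp
    · intro d _ hd
      rw [add_zero] at hd
      subst hd
      rw [(div_pow2B_eq_zero_iff hn x).2 hx, (div_pow2B_eq_zero_iff hn y).2 hy]
    · intro j ih d _ hd
      have hd' : d + 1 + j = n := by rw [← hd]; ring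
      have hdn : d < n := by
        rw [← hd, add_comm j, ← add_assoc]
        exact lt_of_lt_of_le (lt_add_one' d) (le_add_right'' _ _)
      have hdS : d < mLen S := lt_of_lt_of_le hdn hn
      have hle : d + 1 ≤ n := (add_one_le_iff' d n).2 hdn
      rw [div_pow2B_eq hdS x, div_pow2B_eq hdS y, ih (d + 1) hle hd', h d hdn]
  simpa using key n 0 bot_le (zero_add n)

end Bits

/-! ## Monotonicity of terms -/

section Monotone

/-- `#` is monotone in the first argument: with `|x'| = |x| + |v|` for `v = 2ᵏ - 1`,
`x' # y = (x # y)·(v # y) ≥ x # y` (axioms 17, 18). [cite: Buss1986, §2.3] -/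
theorem mSmash_le_mSmash_left {x x' : M} (h : x ≤ x') (y : M) : mSmash x y ≤ mSmash x' y := by
  obtain ⟨k, hk⟩ := exists_add_of_le' (mLen_le_mLen h)
  have hkx' : k ≤ mLen x' := hk ▸ le_add_left'' k _
  have hv : mLen (pow2B x' k - 1) = k := by
    have hp := (isPow_iff.1 (isPow_pow2B x' k)).2
    rw [mLen_pow2B_of_le hkx'] at hp
    exact add_right_cancel hp
  rw [mSmash_eq_mul_of_mLen_eq_add (x := x') (u := x) (v := pow2B x' k - 1) (by rw [hv, hk]) y]
  conv_lhs => rw [← mul_one (mSmash x y)]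
  exact mul_le_mul'' le_rfl ((one_le_iff_ne_zero' _).2 (mSmash_ne_zero _ _))

/-- `#` is monotone. [cite: Buss1986, §2.3] -/
theorem mSmash_le_mSmash {x x' y y' : M} (hx : x ≤ x') (hy : y ≤ y') :
    mSmash x y ≤ mSmash x' y' :=
  (mSmash_le_mSmash_left hx y).trans (by
    rw [mSmash_comm x' y, mSmash_comm x' y']
    exact mSmash_le_mSmash_left hy x')

/-- `⌊·/2⌋` is monotone. [folklore] -/
theorem mHalf_le_mHalf {x y : M} (h : x ≤ y) : mHalf x ≤ mHalf y := by
  rw [← div_two_eq_mHalf, ← div_two_eq_mHalf]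
  exact div_le_div_right_model h 2

omit hB hI in
/-- The interpretation of a unary function symbol, as a function of its argument tuple.
[folklore] -/
theorem funMap_eq₁ (f : BoundedArithFunc 1) (w : Fin 1 → M) :
    Structure.funMap (L := Language.boundedArith) f w =
      Structure.funMap (L := Language.boundedArith) f ![w 0] := by
  congr 1
  funext j
  fin_cases j
  rfl

omit hB hI in
/-- The interpretation of a binary function symbol, as a function of its argument tuple.
[folklore] -/
theorem funMap_eq₂ (f : BoundedArithFunc 2) (w : Fin 2 → M) :
    Structure.funMap (L := Language.boundedArith) f w =
      Structure.funMap (L := Language.boundedArith) f ![w 0, w 1] := by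
  congr 1
  funext j
  fin_cases j <;> rfl

/-- **Every term (with parameters) is monotone** in a model of `T₂¹`: each symbol
`S, ⌊·/2⌋, |·|, +, ·, #` is monotone (Buss 1986, §2.3). [cite: Buss1986, §2.3] -/
theorem realize_term_mono {β : Type} (t : Language.boundedArith.Term (M ⊕ β)) {xs ys : β → M}
    (h : ∀ j, xs j ≤ ys j) : t.realize (Sum.elim id xs) ≤ t.realize (Sum.elim id ys) := by
  induction t with
  | var x =>
    rcases x with a | j
    · exact le_rfl
    · exact h j
  | func f ts ih =>
    simp only [Term.realize]
    cases f with
    | zero => exact le_of_eq (congrArg _ (Subsingleton.elim _ _))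
    | succ =>
      rw [funMap_eq₁, funMap_eq₁ _ (fun i => (ts i).realize (Sum.elim id ys))]
      change mSucc _ ≤ mSucc _
      simpa using ih 0
    | half =>
      rw [funMap_eq₁, funMap_eq₁ _ (fun i => (ts i).realize (Sum.elim id ys))]
      exact mHalf_le_mHalf (ih 0)
    | len =>
      rw [funMap_eq₁, funMap_eq₁ _ (fun i => (ts i).realize (Sum.elim id ys))]
      exact mLen_le_mLen (ih 0)
    | add =>
      rw [funMap_eq₂, funMap_eq₂ _ (fun i => (ts i).realize (Sum.elim id ys))]
      exact add_le_add (ih 0) (ih 1)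
    | mul =>
      rw [funMap_eq₂, funMap_eq₂ _ (fun i => (ts i).realize (Sum.elim id ys))]
      exact mul_le_mul'' (ih 0) (ih 1)
    | smash =>
      rw [funMap_eq₂, funMap_eq₂ _ (fun i => (ts i).realize (Sum.elim id ys))]
      exact mSmash_le_mSmash (ih 0) (ih 1)

/-- **Term functions are monotone** in every argument (Buss 1986, §2.3). [cite: Buss1986, §2.3] -/
theorem _root_.Literature.Computability.MetaComplexity.IsTermFn.monotone {m : ℕ} {F : (Fin m → M) → M} (hF : IsTermFn F) {xs ys : Fin m → M}
    (h : ∀ j, xs j ≤ ys j) : F xs ≤ F ys := by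
  obtain ⟨t, ht⟩ := hF
  rw [ht, ht]
  exact realize_term_mono t h

end Monotone

end BASICModel

end Literature.Computability.MetaComplexity
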